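/-
Copyright: b2b-lace packet (certified numerics seat 3 / enumeration lane, gen 9).  The one-step
END-BOND RECURSION for the trail (bond-avoiding walk) counts `a_n(x) = #trailWordsTo d n x` with an
avoided bond set, its invariance under the signed coordinate permutations `W_d`, vanishing beyond reach
and by parity, and the FRESH-DIMENSION COLLAPSE: from a configuration supported on the first `m`
coordinates, the `2(d - m)` steps into unused coordinates all count the same.  Pure combinatorics over
the tree's own definitions; no numerals; nothing of the record is touched.
-/
import Literature.Probability.FitznerVanDerHofstad2017.TrailCounts
import Literature.Probability.FitznerVanDerHofstad2017.SawCountRecursion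
import HarnessLib

/-!
# The end-bond recursion for trail counts and the fresh-dimension collapse

CITATION HEADER (PLACEMENT v2). This module is part of a certified REPRODUCTION of:
R. Fitzner, R. van der Hofstad, *Mean-field behavior for nearest-neighbor percolation in d > 10*,
Electron. J. Probab. 22 (2017), no. 43, 1–65 [FvdH17], and *Generalized approach to the non-backtracking
lace expansion*, Probab. Theory Related Fields 169 (2017), 1041–1119 [NoBLE17-I] (arXiv:1506.07977, 1506.07969).
Reproduces: the INPUT TABLE `nrBAW[n,d,x]` of the accompanying Mathematica notebook `SRW.nb` §3
("Number of Self-avoiding and Bond-avoiding walks … we have computed the number of self-avoiding walks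
(SAW) and bond-avoiding walks (BAW) with a specific number of steps … These value are computed using a
simple JAVA program"), i.e. the trail counts `a_n(x)` of [NoBLE17-I] §5.3.1 ("the number of n-step simple
random walk from 0 to x that never use a bond twice"), here DERIVED from the tree's definition of trails
(`TrailCounts`: `IsTrail`, `trailWordsTo d n x`).  This file is the combinatorial half, the sibling of
`SawCountRecursion` (sites ↦ bonds); the numbers themselves are evaluated by the kernel in
`TrailCountKernel` / `TrailCountTables`.

## What is here (all `[folklore]`; N. Madras, G. Slade, *The Self-Avoiding Walk* (1993), §1.2 for walks
with a bond constraint)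

* `wordEdge_wordSnoc_of_lt`, `wordEdge_wordSnoc_last`, `isTrail_wordSnoc_iff`: appending a step keeps the
  trail property iff the new bond `{u(n), u(n) + e}` is not among the traversed ones;
* `trailWordsToAvoid d n y E`: the trails of length `n` ending at `y` none of whose bonds lies in the finite
  bond set `E`, and the recursion `trailCount d n y E` with
  **`card_trailWordsToAvoid : #trailWordsToAvoid d n y E = trailCount d n y E`** (split off the last step:
  `a_{n+1}(y; E) = Σ_e [{y-e, y} ∉ E] a_n(y - e; E ∪ {{y-e, y}})`, `a_0(y; E) = [y = 0]`), whence
  **`card_trailWordsTo_eq_trailCount : #trailWordsTo d n y = trailCount d n y ∅`**;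
* **`trailCount_signedPerm`**: `a_n(φ y; φ E) = a_n(y; E)` for every signed coordinate permutation `φ`
  (acting on bonds by `Sym2.map φ`; the steps are permuted by `SawEndpointClasses.stepPerm`);
* `trailCount_eq_zero_of_lt` (`a_n(y; E) = 0` if `n < ‖y‖₁`), `trailCount_eq_zero_of_odd` (parity);
* the **fresh-dimension collapse** `trailCount_succ_of_suppBelow`: if `y` and every end point of a bond of
  `E` are supported on the first `m ≤ d` coordinates, then
  `a_{n+1}(y; E) = Σ_{i<m} ([b_i⁺ ∉ E] a_n(y + e_i; E ∪ {b_i⁺}) + [b_i⁻ ∉ E] a_n(y - e_i; E ∪ {b_i⁻}))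
  + 2(d - m) · a_n(y + e_m; E ∪ {{y + e_m, y}})`, `b_i^± = {y ± e_i, y}` — the `2(d - m)` bonds into unused
  coordinates are new and conjugate under `W_d` elements fixing `y` and `E`.  Iterating, `a_n(x)` for `x`
  supported on `s` coordinates is a polynomial in `d` of degree at most `(n - ‖x‖₁)/2` whose coefficients
  count trails with canonically labelled fresh coordinates (`TrailCountKernel`).

## What is NOT here

No numeral, no dimension is fixed, no cell of the record; no cited fact, no named hypothesis, no `sorry`.

## References
* N. Madras, G. Slade, The Self-Avoiding Walk, Birkhäuser (1993), §1.2 (walks with memory / bond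
  constraints; `c_N ≤` trails `≤ c_{N,2}`).
* R. Fitzner, R. van der Hofstad, Mathematica notebook SRW.nb (2015), §3 "Number of Self-avoiding and
  Bond-avoiding walks" (the table `nrBAW[n,d,x]`, polynomials in d), accompanying [FvdH17]/[NoBLE17-I],
  arXiv:1506.07977 anc.; [NoBLE17-I] §5.3.1 pp. 1096–1097 (`a_n(x)`).
-/

namespace Literature.Probability.FitznerVanDerHofstad2017

open Finset Literature.Probability.LatticeModels Literature.Probability.Percolation
open Literature.Barriers.CriticalPhenomena

variable {d : ℕ}

/-! ### Appending a step and the traversed bonds -/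

/-- The first `n` bonds of `wordSnoc u s` are those of `u`. [folklore] -/
theorem wordEdge_wordSnoc_of_lt {n : ℕ} (u : Fin n → Fin d × Bool) (s : Fin d × Bool) {k : ℕ}
    (hk : k < n) : wordEdge (wordSnoc u s) k = wordEdge u k := by
  rw [wordEdge, wordEdge, wordPos_wordSnoc_of_le u s hk.le, wordPos_wordSnoc_of_le u s hk]

/-- The last bond of `wordSnoc u s` is `{u(n), u(n) + e_s}`. [folklore] -/
theorem wordEdge_wordSnoc_last {n : ℕ} (u : Fin n → Fin d × Bool) (s : Fin d × Bool) :
    wordEdge (wordSnoc u s) n = s(wordPos u n, wordPos u n + stepVec s) := by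
  rw [wordEdge, wordPos_wordSnoc_of_le u s le_rfl, wordPos_wordSnoc_succ]

/-- The first `n` bonds of a word of length `n + 1` are those of its prefix. [folklore] -/
theorem wordEdge_wordInit {n : ℕ} (w : Fin (n + 1) → Fin d × Bool) {k : ℕ} (hk : k < n) :
    wordEdge (wordInit w) k = wordEdge w k := by
  rw [wordEdge, wordEdge, wordPos_wordInit w hk.le, wordPos_wordInit w hk]

/-- **Appending a step keeps the trail property iff the new bond is new.** [folklore] -/
theorem isTrail_wordSnoc_iff {n : ℕ} (u : Fin n → Fin d × Bool) (s : Fin d × Bool) :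
    IsTrail (wordSnoc u s) ↔
      IsTrail u ∧ ∀ k < n, wordEdge u k ≠ s(wordPos u n, wordPos u n + stepVec s) := by
  constructor
  · intro h
    refine ⟨fun i j hi hj hij => ?_, fun k hk hne => ?_⟩
    · exact h i j (by omega) (by omega)
        (by rwa [wordEdge_wordSnoc_of_lt u s hi, wordEdge_wordSnoc_of_lt u s hj])
    · have := h k n (by omega) (lt_add_one n)
        (by rw [wordEdge_wordSnoc_of_lt u s hk, wordEdge_wordSnoc_last]; exact hne)
      omega
  · rintro ⟨hu, hne⟩ i j hi hj hij
    rcases Nat.lt_or_ge i n with hi' | hi' <;> rcases Nat.lt_or_ge j n with hj' | hj'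
    · rw [wordEdge_wordSnoc_of_lt u s hi', wordEdge_wordSnoc_of_lt u s hj'] at hij
      exact hu i j hi' hj' hij
    · obtain rfl : j = n := by omega
      rw [wordEdge_wordSnoc_of_lt u s hi', wordEdge_wordSnoc_last] at hij
      exact absurd hij (hne i hi')
    · obtain rfl : i = n := by omega
      rw [wordEdge_wordSnoc_of_lt u s hj', wordEdge_wordSnoc_last] at hij
      exact absurd hij.symm (hne j hj')
    · omega

/-! ### Trails avoiding a bond set, and the recursion -/

open Classical in
/-- The trails of length `n` ending at `y` whose bonds all lie outside `E`. [folklore] -/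
noncomputable def trailWordsToAvoid (d n : ℕ) (y : Site d) (E : Finset (Sym2 (Site d))) :
    Finset (Fin n → Fin d × Bool) :=
  (trailWordsTo d n y).filter fun w => ∀ k < n, wordEdge w k ∉ E

/-- Membership in `trailWordsToAvoid`. [folklore] -/
theorem mem_trailWordsToAvoid {n : ℕ} {y : Site d} {E : Finset (Sym2 (Site d))}
    {w : Fin n → Fin d × Bool} :
    w ∈ trailWordsToAvoid d n y E ↔ IsTrail w ∧ wordPos w n = y ∧ ∀ k < n, wordEdge w k ∉ E := by
  rw [trailWordsToAvoid, mem_filter, mem_trailWordsTo, and_assoc]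

/-- With nothing to avoid these are all the trails ending at `y`. [folklore] -/
theorem trailWordsToAvoid_empty (n : ℕ) (y : Site d) : trailWordsToAvoid d n y ∅ = trailWordsTo d n y := by
  ext w
  simp [mem_trailWordsToAvoid, mem_trailWordsTo]

open Classical in
/-- The end-bond recursion: `trailCount d 0 y E = [y = 0]`,
`trailCount d (n+1) y E = Σ_e [{y - e, y} ∉ E] trailCount d n (y - e) (E ∪ {{y - e, y}})` (sum over the `2d`
unit steps `e`). [folklore] -/
noncomputable def trailCount (d : ℕ) : ℕ → Site d → Finset (Sym2 (Site d)) → ℕ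
  | 0, y, _ => if y = 0 then 1 else 0
  | n + 1, y, E => ∑ a : Fin d × Bool,
      if s(y - stepVec a, y) ∈ E then 0 else trailCount d n (y - stepVec a) (insert s(y - stepVec a, y) E)

/-- The zero-step value. [folklore] -/
theorem trailCount_zero (y : Site d) (E : Finset (Sym2 (Site d))) :
    trailCount d 0 y E = if y = 0 then 1 else 0 := by
  simp [trailCount]

/-- The recursion step. [folklore] -/
theorem trailCount_succ (n : ℕ) (y : Site d) (E : Finset (Sym2 (Site d))) :
    trailCount d (n + 1) y E = ∑ a : Fin d × Bool,
      if s(y - stepVec a, y) ∈ E then 0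
      else trailCount d n (y - stepVec a) (insert s(y - stepVec a, y) E) := by
  simp [trailCount]

/-- **The recursion counts**: `#trailWordsToAvoid d n y E = trailCount d n y E` (split off the last step).
[folklore] -/
theorem card_trailWordsToAvoid (n : ℕ) :
    ∀ (y : Site d) (E : Finset (Sym2 (Site d))), (trailWordsToAvoid d n y E).card = trailCount d n y E := by
  induction n with
  | zero =>
    intro y E
    rw [trailCount_zero]
    by_cases hy : y = 0
    · subst hy
      rw [if_pos rfl, card_eq_one]
      refine ⟨fun i => i.elim0, eq_singleton_iff_unique_mem.2 ⟨?_, fun w _ => funext fun i => i.elim0⟩⟩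
      rw [mem_trailWordsToAvoid]
      exact ⟨fun i j hi _ _ => by omega, wordPos_zero _, fun k hk => by omega⟩
    · rw [if_neg hy, card_eq_zero, eq_empty_iff_forall_notMem]
      intro w hw
      rw [mem_trailWordsToAvoid] at hw
      exact hy (by rw [← hw.2.1, wordPos_zero])
  | succ n ih =>
    intro y E
    rw [trailCount_succ]
    have hterm : ∀ a : Fin d × Bool,
        (if s(y - stepVec a, y) ∈ E then 0
          else trailCount d n (y - stepVec a) (insert s(y - stepVec a, y) E)) =
        ((trailWordsToAvoid d n (y - stepVec a) (insert s(y - stepVec a, y) E)).filter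
          fun _ => s(y - stepVec a, y) ∉ E).card := by
      intro a
      split_ifs with h
      · rw [filter_false_of_mem (fun _ _ => not_not_intro h), card_empty]
      · rw [filter_true_of_mem (fun _ _ => h), ih]
    simp_rw [hterm]
    rw [← card_sigma]
    refine card_nbij' (fun w => ⟨w ⟨n, lt_add_one n⟩, wordInit w⟩) (fun p => wordSnoc p.2 p.1)
      ?_ ?_ ?_ ?_
    · intro w hw
      simp only [mem_coe, mem_trailWordsToAvoid] at hw
      obtain ⟨hs, hy, hav⟩ := hw
      simp only [mem_coe, mem_sigma, mem_univ, true_and, mem_filter, mem_trailWordsToAvoid]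
      have hlast : wordPos w n + stepVec (w ⟨n, lt_add_one n⟩) = y := by
        rw [← wordPos_succ w (lt_add_one n), hy]
      have hprev : y - stepVec (w ⟨n, lt_add_one n⟩) = wordPos w n := by
        rw [sub_eq_iff_eq_add, hlast]
      have hedge : s(y - stepVec (w ⟨n, lt_add_one n⟩), y) = wordEdge w n := by
        rw [wordEdge, hprev, hy]
      refine ⟨⟨fun i j hi hj hij => hs i j (by omega) (by omega) ?_, ?_, fun k hk => ?_⟩, ?_⟩
      · rwa [wordEdge_wordInit w hi, wordEdge_wordInit w hj] at hij
      · rw [wordPos_wordInit w le_rfl, hprev]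
      · rw [wordEdge_wordInit w hk, mem_insert, not_or, hedge]
        exact ⟨fun h => absurd (hs k n (by omega) (lt_add_one n) h) (by omega), hav k (by omega)⟩
      · rw [hedge]
        exact hav n (lt_add_one n)
    · rintro ⟨a, u⟩ hp
      simp only [mem_coe, mem_sigma, mem_univ, true_and, mem_filter, mem_trailWordsToAvoid] at hp
      obtain ⟨⟨hs, hy, hav⟩, hE⟩ := hp
      simp only [mem_coe, mem_trailWordsToAvoid]
      have hend : wordPos u n + stepVec a = y := by rw [hy, sub_add_cancel]
      have hnew : s(wordPos u n, wordPos u n + stepVec a) = s(y - stepVec a, y) := by rw [hend, hy]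
      refine ⟨(isTrail_wordSnoc_iff u a).2 ⟨hs, fun k hk h => ?_⟩, ?_, fun k hk => ?_⟩
      · exact hav k hk (by rw [h, hnew]; exact mem_insert_self _ E)
      · rw [wordPos_wordSnoc_succ, hend]
      · rcases Nat.lt_or_ge k n with hk' | hk'
        · rw [wordEdge_wordSnoc_of_lt u a hk']
          exact fun h => hav k hk' (mem_insert_of_mem h)
        · obtain rfl : k = n := by omega
          rwa [wordEdge_wordSnoc_last, hnew]
    · intro w _
      exact wordSnoc_wordInit w
    · rintro ⟨a, u⟩ _
      simp

/-- **`a_n(y) = trailCount d n y ∅`**: the trail counts satisfy the end-bond recursion. [folklore] -/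
theorem card_trailWordsTo_eq_trailCount (n : ℕ) (y : Site d) :
    (trailWordsTo d n y).card = trailCount d n y ∅ := by
  rw [← trailWordsToAvoid_empty, card_trailWordsToAvoid]

/-! ### Invariance under the signed coordinate permutations -/

/-- A signed permutation transports the bond `{y - e_κ, y}` to `{φ y - e_{σ κ}, φ y}`. [folklore] -/
theorem sym2Map_signedPerm_stepBond (π : Equiv.Perm (Fin d)) (ε : Fin d → ℤˣ) (y : Site d)
    (a : Fin d × Bool) :
    Sym2.map (Site.signedPerm π ε) s(y - stepVec a, y) =
      s(Site.signedPerm π ε y - stepVec (stepPerm π ε a), Site.signedPerm π ε y) := by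
  rw [Sym2.map_mk, signedPerm_sub, signedPerm_stepVec]

/-- **`W_d`-invariance of the recursion**: `trailCount d n (φ y) (φ E) = trailCount d n y E`, the bond set
being transported by `Sym2.map φ`. [folklore] -/
theorem trailCount_signedPerm (π : Equiv.Perm (Fin d)) (ε : Fin d → ℤˣ) (n : ℕ) :
    ∀ (y : Site d) (E : Finset (Sym2 (Site d))),
      trailCount d n (Site.signedPerm π ε y) (E.image (Sym2.map (Site.signedPerm π ε))) =
        trailCount d n y E := by
  have hinj := Sym2.map.injective (Site.signedPerm π ε).injective
  induction n with
  | zero =>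
    intro y E
    rw [trailCount_zero, trailCount_zero]
    simp only [signedPerm_eq_zero_iff]
  | succ n ih =>
    intro y E
    rw [trailCount_succ, trailCount_succ, ← Equiv.sum_comp (stepPerm π ε)]
    refine sum_congr rfl fun a _ => ?_
    rw [← sym2Map_signedPerm_stepBond]
    by_cases h : s(y - stepVec a, y) ∈ E
    · rw [if_pos h, if_pos (hinj.mem_finset_image.2 h)]
    · rw [if_neg h, if_neg (mt hinj.mem_finset_image.1 h), ← signedPerm_stepVec, ← signedPerm_sub,
        ← image_insert, ih]

/-! ### Vanishing beyond reach and parity -/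

/-- **Out of reach**: `trailCount d n y E = 0` when `n < ‖y‖₁`. [folklore] -/
theorem trailCount_eq_zero_of_lt (n : ℕ) :
    ∀ (y : Site d) (E : Finset (Sym2 (Site d))), n < l1Norm y → trailCount d n y E = 0 := by
  induction n with
  | zero =>
    intro y E h
    rw [trailCount_zero, if_neg]
    rintro rfl
    simp [l1Norm] at h
  | succ n ih =>
    intro y E h
    rw [trailCount_succ]
    refine sum_eq_zero fun a _ => ?_
    split_ifs
    · rfl
    · refine ih _ _ ?_
      rcases l1Norm_sub_stepVec y a with h' | h' <;> omega

/-- **Parity**: `trailCount d n y E = 0` when `n + ‖y‖₁` is odd. [folklore] -/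
theorem trailCount_eq_zero_of_odd (n : ℕ) :
    ∀ (y : Site d) (E : Finset (Sym2 (Site d))), (n + l1Norm y) % 2 = 1 → trailCount d n y E = 0 := by
  induction n with
  | zero =>
    intro y E h
    rw [trailCount_zero, if_neg]
    rintro rfl
    simp [l1Norm] at h
  | succ n ih =>
    intro y E h
    rw [trailCount_succ]
    refine sum_eq_zero fun a _ => ?_
    split_ifs
    · rfl
    · refine ih _ _ ?_
      rcases l1Norm_sub_stepVec y a with h' | h' <;> omega

/-! ### The fresh-dimension collapse -/

/-- The bonds of `E` have all their end points supported on the first `m` coordinates. [folklore] -/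
def BondsSuppBelow (m : ℕ) (E : Finset (Sym2 (Site d))) : Prop := ∀ b ∈ E, ∀ z ∈ b, SuppBelow m z

/-- `BondsSuppBelow` is monotone in `m`. [folklore] -/
theorem BondsSuppBelow.mono {m m' : ℕ} {E : Finset (Sym2 (Site d))} (h : BondsSuppBelow m E)
    (hm : m ≤ m') : BondsSuppBelow m' E :=
  fun b hb z hz => (h b hb z hz).mono hm

/-- The empty bond set is supported anywhere. [folklore] -/
theorem bondsSuppBelow_empty (m : ℕ) : BondsSuppBelow m (∅ : Finset (Sym2 (Site d))) :=
  fun b hb => absurd hb (notMem_empty b)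

/-- Inserting a bond with supported end points. [folklore] -/
theorem BondsSuppBelow.insert {m : ℕ} {E : Finset (Sym2 (Site d))} (h : BondsSuppBelow m E)
    {u v : Site d} (hu : SuppBelow m u) (hv : SuppBelow m v) : BondsSuppBelow m (insert s(u, v) E) := by
  intro b hb z hz
  rcases mem_insert.1 hb with rfl | hb
  · rcases Sym2.mem_iff.1 hz with rfl | rfl
    exacts [hu, hv]
  · exact h b hb z hz

/-- A bond with an end point off the first `m` coordinates is not in a bond set supported there:
`{y + σ e_j, y} ∉ E` for `j ≥ m`, `σ = ±1`, `y` supported below `m`. [folklore] -/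
theorem not_mem_of_bondsSuppBelow {m : ℕ} {E : Finset (Sym2 (Site d))} (hE : BondsSuppBelow m E)
    {y : Site d} (hy : SuppBelow m y) (j : Fin d) (hj : m ≤ (j : ℕ)) (σ : ℤˣ) :
    s(y + (σ : ℤ) • bvec d j, y) ∉ E := by
  intro h
  have h0 := hE _ h (y + (σ : ℤ) • bvec d j) (Sym2.mem_mk_left _ _) j hj
  have hyj := hy j hj
  simp only [Pi.add_apply, Pi.smul_apply, bvec, if_true, smul_eq_mul, mul_one, hyj, zero_add] at h0
  exact σ.ne_zero h0

/-- A signed permutation fixing every vector supported below `m` fixes every bond supported there.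
[folklore] -/
theorem image_sym2Map_eq_of_bondsSuppBelow {m : ℕ} {E : Finset (Sym2 (Site d))} (hE : BondsSuppBelow m E)
    (φ : Site d ≃ Site d) (hφ : ∀ z : Site d, SuppBelow m z → φ z = z) : E.image (Sym2.map φ) = E := by
  have hfix : ∀ b ∈ E, Sym2.map φ b = b := by
    intro b hb
    induction b using Sym2.ind with
    | h u v =>
      rw [Sym2.map_mk, hφ u (hE _ hb u (Sym2.mem_mk_left u v)), hφ v (hE _ hb v (Sym2.mem_mk_right u v))]
  rw [image_congr (show Set.EqOn (Sym2.map φ) id (E : Set (Sym2 (Site d))) from fun b hb => hfix b hb),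
    image_id]

/-- **Fresh directions are conjugate**: from a configuration supported below `m`, the counts after a step
`+e_i`, `-e_i`, `+e_j`, `-e_j` into any two coordinates `i, j ≥ m` (with the new bond recorded) agree.
[folklore] -/
theorem trailCount_fresh_eq {m : ℕ} (n : ℕ) {y : Site d} {E : Finset (Sym2 (Site d))} (hy : SuppBelow m y)
    (hE : BondsSuppBelow m E) (i j : Fin d) (hi : m ≤ (i : ℕ)) (hj : m ≤ (j : ℕ)) (σ : ℤˣ) :
    trailCount d n (y + (σ : ℤ) • bvec d j) (insert s(y + (σ : ℤ) • bvec d j, y) E) =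
      trailCount d n (y + bvec d i) (insert s(y + bvec d i, y) E) := by
  set φ := Site.signedPerm (Equiv.swap i j) (Function.update 1 j σ) with hφdef
  have hfix : ∀ z : Site d, SuppBelow m z → φ z = z :=
    fun z hz => signedPerm_swap_of_suppBelow i j hi hj σ hz
  have hyi : φ (y + bvec d i) = y + (σ : ℤ) • bvec d j := by
    rw [hφdef, Site.signedPerm_add, hfix y hy, signedPerm_swap_bvec]
  have himg : (insert s(y + bvec d i, y) E).image (Sym2.map φ) = insert s(y + (σ : ℤ) • bvec d j, y) E := by
    rw [image_insert, Sym2.map_mk, hyi, hfix y hy, image_sym2Map_eq_of_bondsSuppBelow hE φ hfix]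
  calc trailCount d n (y + (σ : ℤ) • bvec d j) (insert s(y + (σ : ℤ) • bvec d j, y) E)
      = trailCount d n (φ (y + bvec d i)) ((insert s(y + bvec d i, y) E).image (Sym2.map φ)) := by
        rw [hyi, himg]
    _ = trailCount d n (y + bvec d i) (insert s(y + bvec d i, y) E) := trailCount_signedPerm _ _ n _ _

/-- **Fresh-dimension collapse.**  If `y` and the bonds of `E` are supported on the first `m ≤ d`
coordinates, then
`a_{n+1}(y; E) = Σ_{i<m} ([b⁺ ∉ E] a_n(y+e_i; E ∪ {b⁺}) + [b⁻ ∉ E] a_n(y-e_i; E ∪ {b⁻})) + 2(d-m)·a_n(y+e_m; E ∪ {{y+e_m, y}})`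
with `b^± = {y ± e_i, y}`: the `2(d-m)` bonds into unused coordinates are new and all count the same.  (For
`m = d` the last term is `0`.) [folklore] -/
theorem trailCount_succ_of_suppBelow {m : ℕ} (hm : m ≤ d) (n : ℕ) {y : Site d}
    {E : Finset (Sym2 (Site d))} (hy : SuppBelow m y) (hE : BondsSuppBelow m E) :
    trailCount d (n + 1) y E =
      (∑ i ∈ range m,
          ((if s(y + bvec d i, y) ∈ E then 0
            else trailCount d n (y + bvec d i) (insert s(y + bvec d i, y) E)) +
           (if s(y - bvec d i, y) ∈ E then 0
            else trailCount d n (y - bvec d i) (insert s(y - bvec d i, y) E)))) +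
        2 * (d - m) * trailCount d n (y + bvec d m) (insert s(y + bvec d m, y) E) := by
  classical
  let g : ℕ → ℕ := fun i =>
    (if s(y + bvec d i, y) ∈ E then 0 else trailCount d n (y + bvec d i) (insert s(y + bvec d i, y) E)) +
      (if s(y - bvec d i, y) ∈ E then 0 else trailCount d n (y - bvec d i) (insert s(y - bvec d i, y) E))
  have hsum : (∑ a : Fin d × Bool,
      if s(y - stepVec a, y) ∈ E then 0
      else trailCount d n (y - stepVec a) (insert s(y - stepVec a, y) E)) = ∑ i ∈ range d, g i := by
    rw [Fintype.sum_prod_type, ← Fin.sum_univ_eq_sum_range]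
    refine Fintype.sum_congr _ _ fun k => ?_
    rw [Fintype.sum_bool, stepVec_true, stepVec_false, sub_neg_eq_add, add_comm]
  rw [trailCount_succ, hsum, ← sum_range_add_sum_Ico g hm]
  congr 1
  have hconst : ∀ i ∈ Ico m d, g i = 2 * trailCount d n (y + bvec d m) (insert s(y + bvec d m, y) E) := by
    intro i hi
    rw [mem_Ico] at hi
    have hmd : m < d := by omega
    have h1 := trailCount_fresh_eq n hy hE ⟨m, hmd⟩ ⟨i, hi.2⟩ le_rfl hi.1 1
    have h2 := trailCount_fresh_eq n hy hE ⟨m, hmd⟩ ⟨i, hi.2⟩ le_rfl hi.1 (-1)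
    have n1 := not_mem_of_bondsSuppBelow hE hy ⟨i, hi.2⟩ hi.1 1
    have n2 := not_mem_of_bondsSuppBelow hE hy ⟨i, hi.2⟩ hi.1 (-1)
    rw [Units.val_one, one_smul] at h1 n1
    rw [Units.val_neg, Units.val_one, neg_smul, one_smul, ← sub_eq_add_neg] at h2 n2
    show (if s(y + bvec d i, y) ∈ E then 0 else trailCount d n (y + bvec d i) (insert s(y + bvec d i, y) E)) +
      (if s(y - bvec d i, y) ∈ E then 0 else trailCount d n (y - bvec d i) (insert s(y - bvec d i, y) E)) = _
    rw [if_neg n1, if_neg n2, h1, h2]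
    ring
  rw [sum_congr rfl hconst, sum_const, Nat.card_Ico, smul_eq_mul]
  ring

end Literature.Probability.FitznerVanDerHofstad2017
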